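import Summits.ResolutionOfSingularities.ResolutionOfSingularities.Theses.HomologicalConductor

/-!
# `StrictDrop` (crux stmt-ResolutionOfSingularities-16485, route `HomologicalConductor`):
# finite generation of `A` is load-bearing, and a frozen singular stage is fatal
# (negative-side support, refuter crux-disprover seat; this file does NOT refute the crux)

`StrictDrop` says: for every prime `p`, fields `k ⊆ K` of characteristic `p`, valuation ring
`O ⊇ k` of `K` and FINITELY GENERATED `k`-subalgebra `A ⊆ O` with `Frac A = K`, along the
canonical normalised cohomology-annihilator tower `T₀ = A_centre`,
`T_(m+1) = (normalisation of T_m[ca(T_m)/x])_centre`, every non-regular stage `T_m` is followed by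
a stage `T_(m')` carrying a non-zero `y ∈ ca(T_(m'))` of value strictly below all of
`ca(T_m) ∖ 0`.

Recorded here, sorry-free:

* `natRec_const` / `natRec_frozen` / `not_drop_of_frozen` — if `loc`, `chart` and `nrm` all fix
  `A` then every stage is `A` (the tower is FROZEN); a stationary stage stays stationary; and a
  frozen stage that is not a regular local ring violates the conclusion of the crux at that stage
  (witness `x = y`: `y · y⁻¹ = 1 ∈ O`). No cohomology annihilator is computed. Consequence (stated
  over the named tower in the crux workfile `Cruxes/StrictDrop/Disproof.lean`,
  `frozen_regular_of_strictDrop`): `StrictDrop` IMPLIES that every stationary stage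
  `T_(n+1) = T_n` of every canonical tower is regular — the lead's stub `stub_stationary_regular`
  (line `birth`) is NECESSARY for the crux, not only sufficient, even without its tower-shape
  hypothesis. (Recipe: `not_drop_of_frozen (fun m => tower O A m) O (natRec_frozen _ _ h) hsing`.)
* `strictDrop_false_without_FG` — the crux with the single hypothesis `A.FG` deleted (stated
  inline, verbatim otherwise; no proposition is defined under `Summits/`) is FALSE. Witness:
  `p = 2`, `k = 𝔽₂`, `K = 𝔽₂((t^ℚ))` (Hahn series with rational exponents), `O` = its `t`-adic
  valuation ring (value group `ℚ`, non-discrete), `A = O`: a valuation ring is local at its own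
  centre (`loc` fixes it), the chart adjoins only elements of `O = A` (`chart` fixes it),
  valuation rings are integrally closed (`nrm` fixes it), so the tower is frozen at `T₀ = O`,
  which is not noetherian — the principal ideals `(t^(1/2^n))` increase strictly — hence not
  `IsRegularLocalRing`.

Moral for provers: the ONLY thing that makes `¬ IsRegularLocalRing T_m` mean "singular" rather
than "not noetherian" is finite generation of `A` carried along the tower (finite normalisation of
affine domains, the lead's `stub_towerShape`, route constraint C4); and any refutation of the crux
itself must exhibit either a frozen singular stage (for noetherian normal stages this is excluded
exactly by Iyengar–Takahashi Thm 5.4 + `R₁`, the lead's `stub_stationary_regular`) or an infinite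
strictly increasing tower at constant minimal conductor value.

Implementation note: the route's tower is `let`-bound and no definition may be added here, so the
statements below spell the crux's own terms out (`loc` = the first `Algebra.adjoin`, `chart` = the
adjunction of `ca/x`, `nrm` = the adjunction of the integral elements, the tower = the `Nat.rec`);
all comparisons with the crux are by ζβ-unfolding at a variable stage `m` (never at `m + 1`, where
ι-reduction of the fully expanded `Nat.rec` is prohibitively slow). The same lemmas over NAMED
`ca/loc/chart/nrm/tower` are in the crux workfile `Cruxes/StrictDrop/Disproof.lean`.
-/

noncomputable section

-- single-problem summit: the doubled namespace component `ResolutionOfSingularities` is forced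
set_option linter.dupNamespace false

namespace Summit.ResolutionOfSingularities.ResolutionOfSingularities.Theorems.StrictDrop.Negative

/-! ## Frozen towers (abstract `Nat.rec` towers `T_(m+1) = step (T_m)`; tiny terms, so that
the route's fully expanded tower is only ever compared by definitional unfolding) -/

section Abstract

/-- A `Nat.rec` tower whose base and step fix `a` is constantly `a`. [folklore] -/
theorem natRec_const {α : Type} (a T0 : α) (step : α → α) (h0 : T0 = a) (hstep : step a = a)
    (m : ℕ) : @Nat.rec (fun _ => α) T0 (fun _ B => step B) m = a := by
  induction m with
  | zero => exact h0
  | succ m ih =>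
    show step (@Nat.rec (fun _ => α) T0 (fun _ B => step B) m) = a
    rw [ih, hstep]

/-- **Frozen stages stay frozen**: if stage `n + 1` of a `Nat.rec` tower equals stage `n`, so
does every later stage. [folklore] -/
theorem natRec_frozen {α : Type} (T0 : α) (step : α → α) {n : ℕ}
    (h : @Nat.rec (fun _ => α) T0 (fun _ B => step B) (n + 1) =
      @Nat.rec (fun _ => α) T0 (fun _ B => step B) n) :
    ∀ m, n ≤ m → @Nat.rec (fun _ => α) T0 (fun _ B => step B) m =
      @Nat.rec (fun _ => α) T0 (fun _ B => step B) n := by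
  intro m hm
  obtain ⟨d, rfl⟩ := Nat.exists_eq_add_of_le hm
  induction d with
  | zero => rfl
  | succ d ih =>
    have ih' := ih (Nat.le_add_right n d)
    show step (@Nat.rec (fun _ => α) T0 (fun _ B => step B) (n + d)) = _
    rw [ih']
    exact h

end Abstract

/-! ## The three steps fix suitable subalgebras; a frozen non-regular stage violates the drop -/

section Steps

variable {k K : Type} [Field k] [Field K] [Algebra k K]

/-- `loc` fixes a subalgebra `A ⊆ O` that is local at the centre of `O`. [folklore] -/
theorem loc_eq_self (O : ValuationSubring K) (A : Subalgebra k K)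
    (hAO : ∀ x ∈ A, x ∈ O) (hunit : ∀ s ∈ A, s⁻¹ ∈ O → s⁻¹ ∈ A) : (Algebra.adjoin k {y | ∃ a ∈ A, ∃ s ∈ A, s⁻¹ ∈ O ∧ y = a * s⁻¹}) = A := by
  refine le_antisymm (Algebra.adjoin_le ?_) fun a ha => Algebra.subset_adjoin ?_
  · rintro y ⟨a, ha, s, hs, hsO, rfl⟩
    have _ := hAO a ha
    exact A.mul_mem ha (hunit s hs hsO)
  · exact ⟨a, ha, 1, A.one_mem, by simp, by simp⟩

/-- `chart` fixes a subalgebra containing `O` (the chart adjoins only elements of `O`). [folklore] -/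
theorem chart_eq_self (O : ValuationSubring K) (A : Subalgebra k K) (hOA : ∀ x ∈ O, x ∈ A) :
    (Algebra.adjoin k ((A : Set _) ∪ {y | ∃ c ∈ {x | ∃ hx : x ∈ A, ∃ n : ℕ, ∀ i : ℕ, n ≤ i → ∀ (M N : ModuleCat.{0} ↥A), Module.Finite ↥A M → Module.Finite ↥A N → ∀ e : CategoryTheory.Abelian.Ext.{0} M N i, (⟨x, hx⟩ : ↥A) • e = 0}, ∃ x ∈ {x | ∃ hx : x ∈ A, ∃ n : ℕ, ∀ i : ℕ, n ≤ i → ∀ (M N : ModuleCat.{0} ↥A), Module.Finite ↥A M → Module.Finite ↥A N → ∀ e : CategoryTheory.Abelian.Ext.{0} M N i, (⟨x, hx⟩ : ↥A) • e = 0}, x ≠ 0 ∧ (∀ c' ∈ {x | ∃ hx : x ∈ A, ∃ n : ℕ, ∀ i : ℕ, n ≤ i → ∀ (M N : ModuleCat.{0} ↥A), Module.Finite ↥A M → Module.Finite ↥A N → ∀ e : CategoryTheory.Abelian.Ext.{0} M N i, (⟨x, hx⟩ : ↥A) • e = 0}, c' * x⁻¹ ∈ O) ∧ y = c * x⁻¹}))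 = A := by
  refine le_antisymm (Algebra.adjoin_le ?_) fun a ha => Algebra.subset_adjoin (Or.inl ha)
  rintro y (hy | ⟨c, hc, x, _, _, hxmin, rfl⟩)
  · exact hy
  · exact hOA _ (hxmin c hc)

/-- `nrm` fixes a subalgebra that is integrally closed in `K`. [folklore] -/
theorem nrm_eq_self (A : Subalgebra k K) (hint : ∀ y : K, IsIntegral ↥A y → y ∈ A) :
    (Algebra.adjoin k {y | IsIntegral ↥A y}) = A := by
  refine le_antisymm (Algebra.adjoin_le fun y hy => hint y hy) fun b hb => Algebra.subset_adjoin ?_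
  show IsIntegral (↥A) b
  have : b = algebraMap (↥A) K ⟨b, hb⟩ := rfl
  rw [this]
  exact isIntegral_algebraMap

/-- **A frozen non-regular stage violates the drop conclusion** (witness `x = y`:
`y * y⁻¹ = 1 ∈ O`; no annihilator is computed). Here `T` is any sequence of subalgebras; the
crux conclusion at one input `(O, A)` has exactly this shape with `T m = T_m`. [folklore] -/
theorem not_drop_of_frozen (T : ℕ → Subalgebra k K) (O : ValuationSubring K) {n : ℕ}
    (hfrozen : ∀ m, n ≤ m → T m = T n) (hsing : ¬ IsRegularLocalRing ↥(T n)) :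
    ¬ (∀ m : ℕ, ¬ IsRegularLocalRing ↥(T m) → ∃ m' : ℕ, m < m' ∧
        ∃ y ∈ {x | ∃ hx : x ∈ (T m'), ∃ n : ℕ, ∀ i : ℕ, n ≤ i → ∀ (M N : ModuleCat.{0} ↥(T m')), Module.Finite ↥(T m') M → Module.Finite ↥(T m') N → ∀ e : CategoryTheory.Abelian.Ext.{0} M N i, (⟨x, hx⟩ : ↥(T m')) • e = 0}, y ≠ 0 ∧ ∀ x ∈ {x | ∃ hx : x ∈ (T m), ∃ n : ℕ, ∀ i : ℕ, n ≤ i → ∀ (M N : ModuleCat.{0} ↥(T m)), Module.Finite ↥(T m) M → Module.Finite ↥(T m) N → ∀ e : CategoryTheory.Abelian.Ext.{0} M N i, (⟨x, hx⟩ : ↥(T m)) • e = 0}, x ≠ 0 → y * x⁻¹ ∉ O) := by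
  intro hC
  obtain ⟨m', hlt, y, hy, hy0, hval⟩ := hC n hsing
  rw [hfrozen m' hlt.le] at hy
  exact hval y hy hy0 (by rw [mul_inv_cancel₀ hy0]; exact O.one_mem)

end Steps

/-! ## The witness: the valuation ring of `𝔽₂((t^ℚ))` -/

section Witness

/-- Membership in the valuation ring `O` of `K = 𝔽₂((t^ℚ))` is non-negativity of the order. [folklore] -/
theorem mem_O_iff {x : (HahnSeries ℚ (ZMod 2))} : x ∈ (AddValuation.toValuation (HahnSeries.addVal ℚ (ZMod 2))).valuationSubring ↔ 0 ≤ (HahnSeries.addVal ℚ (ZMod 2)) x := Iff.rfl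

/-- Monomials of non-negative exponent lie in `O`. [folklore] -/
theorem single_mem_O {q : ℚ} (hq : 0 ≤ q) (r : ZMod 2) : HahnSeries.single q r ∈ (AddValuation.toValuation (HahnSeries.addVal ℚ (ZMod 2))).valuationSubring := by
  rw [mem_O_iff, HahnSeries.addVal_apply]
  exact (WithTop.coe_le_coe.mpr hq).trans HahnSeries.orderTop_single_le

/-- `𝔽₂ ⊆ O` (the image of `c ∈ {0, 1}` is `0` or `1`). [folklore] -/
theorem algebraMap_mem_O (c : ZMod 2) : algebraMap (ZMod 2) (HahnSeries ℚ (ZMod 2)) c ∈ (AddValuation.toValuation (HahnSeries.addVal ℚ (ZMod 2))).valuationSubring := by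
  have hc : ∀ c : ZMod 2, c = 0 ∨ c = 1 := by decide
  rcases hc c with rfl | rfl
  · rw [map_zero]; exact (AddValuation.toValuation (HahnSeries.addVal ℚ (ZMod 2))).valuationSubring.zero_mem
  · rw [map_one]; exact (AddValuation.toValuation (HahnSeries.addVal ℚ (ZMod 2))).valuationSubring.one_mem

/-- `O` is (the carrier of) an `𝔽₂`-subalgebra of `K = 𝔽₂((t^ℚ))`. [folklore] -/
theorem exists_subalgebra : ∃ A : Subalgebra (ZMod 2) (HahnSeries ℚ (ZMod 2)), ∀ x, x ∈ A ↔ x ∈ (AddValuation.toValuation (HahnSeries.addVal ℚ (ZMod 2))).valuationSubring :=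
  ⟨{ (AddValuation.toValuation (HahnSeries.addVal ℚ (ZMod 2))).valuationSubring.toSubring with algebraMap_mem' := algebraMap_mem_O }, fun _ => Iff.rfl⟩

variable (A : Subalgebra (ZMod 2) (HahnSeries ℚ (ZMod 2))) (hA : ∀ x, x ∈ A ↔ x ∈ (AddValuation.toValuation (HahnSeries.addVal ℚ (ZMod 2))).valuationSubring)
include hA

/-- `K = Frac A` for `A = O` (a valuation ring of `K`). [folklore] -/
theorem isFractionRing_of_eq : IsFractionRing ↥A (HahnSeries ℚ (ZMod 2)) where
  map_units := fun ⟨y, hy⟩ =>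
    (Units.mk0 (y : (HahnSeries ℚ (ZMod 2))) fun c => nonZeroDivisors.ne_zero hy <| Subtype.ext c).isUnit
  surj z := by
    by_cases h : z = 0
    · exact ⟨(0, 1), by simp [h]⟩
    rcases (AddValuation.toValuation (HahnSeries.addVal ℚ (ZMod 2))).valuationSubring.mem_or_inv_mem z with hh | hh
    · exact ⟨(⟨z, (hA z).mpr hh⟩, 1), by simp⟩
    · refine ⟨⟨1, ⟨⟨_, (hA _).mpr hh⟩, ?_⟩⟩, ?_⟩
      · exact mem_nonZeroDivisors_iff_ne_zero.2 fun c => h (inv_eq_zero.mp (congr_arg Subtype.val c))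
      · simp [mul_inv_cancel₀ h]
  exists_of_eq {a b} h := ⟨1, by
    have : (a : (HahnSeries ℚ (ZMod 2))) = b := by simpa using h
    simpa using Subtype.ext this⟩

/-- `A = O` is a ring of integers of the valuation. [folklore] -/
theorem integers_of_eq : (AddValuation.toValuation (HahnSeries.addVal ℚ (ZMod 2))).Integers ↥A where
  hom_inj := Subtype.coe_injective
  map_le_one := fun r => (hA r).mp r.2
  exists_of_le_one := fun r hr => ⟨⟨r, (hA r).mpr hr⟩, rfl⟩

/-- `A = O` is integrally closed in `K`. [folklore] -/
theorem mem_of_isIntegral {y : (HahnSeries ℚ (ZMod 2))} (hy : IsIntegral ↥A y) : y ∈ A :=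
  (hA y).mpr ((integers_of_eq A hA).mem_of_integral hy)

/-- `A = O` is NOT noetherian: the principal ideals `(t^(1/2^n))` increase strictly. [folklore] -/
theorem not_isNoetherianRing_of_eq : ¬ IsNoetherianRing ↥A := by
  intro hN
  -- the elements `t^(1/2^n) ∈ A`
  let t : ℕ → ↥A := fun n =>
    ⟨HahnSeries.single ((1 : ℚ) / 2 ^ n) (1 : ZMod 2), (hA _).mpr (single_mem_O (by positivity) 1)⟩
  have ht : ∀ n, t (n + 1) * t (n + 1) = t n := by
    intro n
    apply Subtype.ext
    show HahnSeries.single _ _ * HahnSeries.single _ _ = HahnSeries.single _ _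
    have hq : (1 : ℚ) / 2 ^ (n + 1) + 1 / 2 ^ (n + 1) = 1 / 2 ^ n := by
      rw [pow_succ]; field_simp; norm_num
    rw [HahnSeries.single_mul_single, mul_one, hq]
  -- the increasing chain of principal ideals stabilises
  let chain : ℕ →o Ideal ↥A :=
    ⟨fun n => Ideal.span {t n}, monotone_nat_of_le_succ fun n =>
      Ideal.span_singleton_le_span_singleton.mpr ⟨t (n + 1), (ht n).symm⟩⟩
  obtain ⟨n, hn⟩ := (monotone_stabilizes_iff_noetherian.mpr hN) chain
  have hmem : t (n + 1) ∈ Ideal.span {t n} := by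
    have : chain n = chain (n + 1) := hn (n + 1) (Nat.le_succ n)
    change t (n + 1) ∈ chain n
    rw [this]
    exact Ideal.subset_span rfl
  obtain ⟨g, hg⟩ := Ideal.mem_span_singleton'.mp hmem
  -- compare orders: `ord g + 1/2^n = 1/2^(n+1)` with `ord g ≥ 0`
  have hgK : (g : (HahnSeries ℚ (ZMod 2))) * HahnSeries.single ((1 : ℚ) / 2 ^ n) 1 =
      HahnSeries.single ((1 : ℚ) / 2 ^ (n + 1)) 1 := congr_arg Subtype.val hg
  have hg0 : (g : (HahnSeries ℚ (ZMod 2))) ≠ 0 := by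
    intro h0
    rw [h0, zero_mul] at hgK
    exact HahnSeries.single_ne_zero one_ne_zero hgK.symm
  have hord := congr_arg HahnSeries.order hgK
  rw [HahnSeries.order_mul hg0 (HahnSeries.single_ne_zero one_ne_zero),
    HahnSeries.order_single one_ne_zero, HahnSeries.order_single one_ne_zero] at hord
  have hgv : 0 ≤ (g : (HahnSeries ℚ (ZMod 2))).order := by
    have := (hA _).mp g.2
    rw [mem_O_iff, HahnSeries.addVal_apply, ← HahnSeries.order_eq_orderTop_of_ne_zero hg0,
      ← WithTop.coe_zero, WithTop.coe_le_coe] at this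
    exact this
  have hlt : (1 : ℚ) / 2 ^ (n + 1) < 1 / 2 ^ n := by
    apply one_div_lt_one_div_of_lt (by positivity)
    exact pow_lt_pow_right₀ (by norm_num) (Nat.lt_succ_self n)
  linarith

/-- `A = O` is not a regular local ring (it is not even noetherian). [folklore] -/
theorem not_isRegularLocalRing_of_eq : ¬ IsRegularLocalRing ↥A := by
  intro h
  exact not_isNoetherianRing_of_eq A hA inferInstance

/-- The canonical tower of `(O, A = O)` is frozen at `A`. [folklore] -/
theorem tower_eq_of_eq (m : ℕ) : (@Nat.rec (fun _ => Subalgebra (ZMod 2) _) (Algebra.adjoin (ZMod 2) {y | ∃ a ∈ A, ∃ s ∈ A, s⁻¹ ∈ (AddValuation.toValuation (HahnSeries.addVal ℚ (ZMod 2))).valuationSubring ∧ y = a * s⁻¹}) (fun _ B => (Algebra.adjoin (ZMod 2) {y | ∃ a ∈ (Algebra.adjoin (ZMod 2) {y | IsIntegral ↥(Algebra.adjoin (ZMod 2) ((B : Set _) ∪ {y | ∃ c ∈ {x | ∃ hx : x ∈ B, ∃ n : ℕ, ∀ i : ℕ, n ≤ i → ∀ (M N : ModuleCat.{0} ↥B),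 Module.Finite ↥B M → Module.Finite ↥B N → ∀ e : CategoryTheory.Abelian.Ext.{0} M N i, (⟨x, hx⟩ : ↥B) • e = 0}, ∃ x ∈ {x | ∃ hx : x ∈ B, ∃ n : ℕ, ∀ i : ℕ, n ≤ i → ∀ (M N : ModuleCat.{0} ↥B), Module.Finite ↥B M → Module.Finite ↥B N → ∀ e : CategoryTheory.Abelian.Ext.{0} M N i, (⟨x, hx⟩ : ↥B) • e = 0}, x ≠ 0 ∧ (∀ c' ∈ {x | ∃ hx : x ∈ B, ∃ n : ℕ, ∀ i : ℕ, n ≤ i → ∀ (M N : ModuleCat.{0} ↥B), Module.Finite ↥B M → Module.Finite ↥B N → ∀ e : CategoryTheory.Abelian.Ext.{0} M N i, (⟨x, hx⟩ : ↥B) • e = 0}, c' * x⁻¹ ∈ (AddValuation.toValuation (HahnSeries.addVal ℚ (ZMod 2))).valuationSubring) ∧ y = c * x⁻¹})) y}), ∃ s ∈ (Algebra.adjoin (ZMod 2) {y | IsIntegral ↥(Algebra.adjoin (ZMod 2) ((B : Set _) ∪ {y | ∃ c ∈ {x | ∃ hx : x ∈ B, ∃ n : ℕ, ∀ i : ℕ,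 n ≤ i → ∀ (M N : ModuleCat.{0} ↥B), Module.Finite ↥B M → Module.Finite ↥B N → ∀ e : CategoryTheory.Abelian.Ext.{0} M N i, (⟨x, hx⟩ : ↥B) • e = 0}, ∃ x ∈ {x | ∃ hx : x ∈ B, ∃ n : ℕ, ∀ i : ℕ, n ≤ i → ∀ (M N : ModuleCat.{0} ↥B), Module.Finite ↥B M → Module.Finite ↥B N → ∀ e : CategoryTheory.Abelian.Ext.{0} M N i, (⟨x, hx⟩ : ↥B) • e = 0}, x ≠ 0 ∧ (∀ c' ∈ {x | ∃ hx : x ∈ B, ∃ n : ℕ, ∀ i : ℕ, n ≤ i → ∀ (M N : ModuleCat.{0} ↥B), Module.Finite ↥B M → Module.Finite ↥B N → ∀ e : CategoryTheory.Abelian.Ext.{0} M N i, (⟨x, hx⟩ : ↥B) • e = 0}, c' * x⁻¹ ∈ (AddValuation.toValuation (HahnSeries.addVal ℚ (ZMod 2))).valuationSubring) ∧ y = c * x⁻¹})) y}), s⁻¹ ∈ (AddValuation.toValuation (HahnSeries.addVal ℚ (ZMod 2))).valuationSubring ∧ y = a * s⁻¹})) m) = A := by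
  have hloc : (Algebra.adjoin (ZMod 2) {y | ∃ a ∈ A, ∃ s ∈ A, s⁻¹ ∈ (AddValuation.toValuation (HahnSeries.addVal ℚ (ZMod 2))).valuationSubring ∧ y = a * s⁻¹}) = A :=
    loc_eq_self _ A (fun x hx => (hA x).mp hx) (fun _ _ hs => (hA _).mpr hs)
  have hchart : (Algebra.adjoin (ZMod 2) ((A : Set _) ∪ {y | ∃ c ∈ {x | ∃ hx : x ∈ A, ∃ n : ℕ, ∀ i : ℕ, n ≤ i → ∀ (M N : ModuleCat.{0} ↥A), Module.Finite ↥A M → Module.Finite ↥A N → ∀ e : CategoryTheory.Abelian.Ext.{0} M N i, (⟨x, hx⟩ : ↥A) • e = 0}, ∃ x ∈ {x | ∃ hx : x ∈ A, ∃ n : ℕ, ∀ i : ℕ, n ≤ i → ∀ (M N : ModuleCat.{0} ↥A), Module.Finite ↥A M → Module.Finite ↥A N → ∀ e : CategoryTheory.Abelian.Ext.{0} M N i, (⟨x, hx⟩ : ↥A) • e = 0}, x ≠ 0 ∧ (∀ c' ∈ {x | ∃ hx : x ∈ A, ∃ n : ℕ, ∀ i : ℕ, n ≤ i → ∀ (M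 N : ModuleCat.{0} ↥A), Module.Finite ↥A M → Module.Finite ↥A N → ∀ e : CategoryTheory.Abelian.Ext.{0} M N i, (⟨x, hx⟩ : ↥A) • e = 0}, c' * x⁻¹ ∈ (AddValuation.toValuation (HahnSeries.addVal ℚ (ZMod 2))).valuationSubring) ∧ y = c * x⁻¹})) = A := chart_eq_self _ A fun x hx => (hA x).mpr hx
  have hnrm : (Algebra.adjoin (ZMod 2) {y | IsIntegral ↥A y}) = A := nrm_eq_self A fun _ hy => mem_of_isIntegral A hA hy
  refine natRec_const A _ _ hloc ?_ m
  rw [hchart, hnrm, hloc]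

/-! ## The negative lemma -/

omit A hA in
/-- **Any proof of `StrictDrop` must use `A.FG`.** The statement below is VERBATIM the crux
`HomologicalConductor.StrictDrop` with the single hypothesis `A.FG →` deleted, and it is false:
witness `p = 2`, `k = 𝔽₂`, `K = 𝔽₂((t^ℚ))`, `O` = its valuation ring, `A = O` — the tower is
frozen at the non-noetherian stage `T₀ = O` (`tower_eq_of_eq`, `not_isRegularLocalRing_of_eq`)
and a frozen non-regular stage violates the conclusion (`not_drop_of_frozen`).
[folklore] -/
theorem strictDrop_false_without_FG : ¬ (
    ∀ p : ℕ, p.Prime → ∀ (k K : Type) [Field k] [CharP k p] [Field K] [Algebra k K] (O : ValuationSubring K) (A : Subalgebra k K), (∀ c : k, algebraMap k K c ∈ O) → IsFractionRing ↥A K → A.toSubring ≤ O.toSubring → let ca : Subalgebra k K → Set K := fun A => {x : K | ∃ hx : x ∈ A, ∃ n : ℕ, ∀ i : ℕ, n ≤ i → ∀ (M N : ModuleCat.{0} ↥A), Module.Finite ↥A M → Module.Finite ↥A N → ∀ e : CategoryTheory.Abelian.Ext.{0} M N i, (⟨x, hx⟩ : ↥A) • e = 0}; let loc : Subalgebra k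 K → Subalgebra k K := fun A => Algebra.adjoin k {y : K | ∃ a ∈ A, ∃ s ∈ A, s⁻¹ ∈ O ∧ y = a * s⁻¹}; let chart : Subalgebra k K → Subalgebra k K := fun A => Algebra.adjoin k ((A : Set K) ∪ {y : K | ∃ c ∈ ca A, ∃ x ∈ ca A, x ≠ 0 ∧ (∀ c' ∈ ca A, c' * x⁻¹ ∈ O) ∧ y = c * x⁻¹}); let nrm : Subalgebra k K → Subalgebra k K := fun B => Algebra.adjoin k {y : K | IsIntegral ↥B y}; let tower : Subalgebra k K → ℕ → Subalgebra k K := fun A m => @Nat.rec (fun _ => Subalgebra k K) (loc A) (fun _ B => loc (nrm (chart B))) m; ∀ m : ℕ, ¬ IsRegularLocalRing ↥(tower A m) → ∃ m' : ℕ, m < m' ∧ ∃ y ∈ ca (tower A m'), y ≠ 0 ∧ ∀ x ∈ ca (tower A m), x ≠ 0 → y * x⁻¹ ∉ O) := by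
  intro h
  obtain ⟨A, hA⟩ := exists_subalgebra
  refine not_drop_of_frozen _ (AddValuation.toValuation (HahnSeries.addVal ℚ (ZMod 2))).valuationSubring (n := 0)
    (fun m _ => (tower_eq_of_eq A hA m).trans (tower_eq_of_eq A hA 0).symm) ?_
    (h 2 Nat.prime_two (ZMod 2) (HahnSeries ℚ (ZMod 2)) (AddValuation.toValuation (HahnSeries.addVal ℚ (ZMod 2))).valuationSubring A algebraMap_mem_O
      (isFractionRing_of_eq A hA) (fun x hx => (hA x).mp hx))
  rw [tower_eq_of_eq A hA 0]
  exact not_isRegularLocalRing_of_eq A hA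

end Witness

end Summit.ResolutionOfSingularities.ResolutionOfSingularities.Theorems.StrictDrop.Negative

end
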